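import Summits.Ventures.Crystal3D.Bulk.CapCutCheck
import HarnessLib

/-!
# Cap-cut certificates: the (I) check with block hints

Venture `Crystal3D` (cell `pub-crystal3d`, phase 2; seat p3). `CapCutCheck.lean` checks inequality (I)
of a cap certificate `c` (`K(u,u,1) ≤ D` on `[u₀,1]`) in one kernel evaluation that rebuilds the
diagonal polynomial `Σ_k (1-u²)^k B_k(u)`, `B_k = Σ_r g_{k,r}²`, from the data. For certificates of the
size of the cell's level-4 cut (`d = 16`, coefficients of ≈ 120 bits) a single evaluation is at the
edge of what plain `lean` replays, so this file splits it: the block polynomials are supplied as a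
HINT `B : List (List ℚ)`, each hint is confirmed separately (`B.getD k [] = blockDiagN c k c.R`, one
small `decide +kernel` per block), and the Taylor-form cover check runs on the hints
(`checkIneqIB`). Soundness `ineqI_of_checkB` reduces to `ineqI_of_check`. Bookkeeping only.
-/

open Literature.Geometry.DiscreteGeometry.BachocVallentin

namespace Summit.Ventures.Crystal3D.CapCut

/-- The diagonal polynomial assembled from block hints: `Σ_{k<n} (1-u²)^k · B[k]`. [folklore] -/
def diagOfBlocksN (B : List (List ℚ)) : ℕ → List ℚ
  | 0 => []
  | k + 1 => padd (diagOfBlocksN B k) (pmul (ppow [1, 0, -1] k) (B.getD k []))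

/-- With correct hints the assembled diagonal IS the certificate's diagonal polynomial. [folklore] -/
theorem diagOfBlocksN_eq (c : CapCert) (B : List (List ℚ)) :
    ∀ n : ℕ, (∀ k, k < n → B.getD k [] = blockDiagN c k c.R) →
      diagOfBlocksN B n = diagPolyN c n := by
  intro n
  induction n with
  | zero => intro _; rfl
  | succ n ih =>
    intro h
    simp only [diagOfBlocksN, diagPolyN]
    rw [ih (fun k hk => h k (Nat.lt_succ_of_lt hk)), h n (Nat.lt_succ_self n)]

/-- KERNEL CHECK of inequality (I) from block hints: the chained Taylor-form box test applied to
`D - Σ_k (1-u²)^k B[k]`. [cite: BachocVallentin2009, Theorem 4.4 (d)] -/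
def checkIneqIB (c : CapCert) (D : ℚ) (pts : List ℚ) (B : List (List ℚ)) : Bool :=
  checkCover (padd [D] (pscale (-1) (diagOfBlocksN B c.L.length))) c.u0 pts 1

/-- With correct hints, `checkIneqIB` is `checkIneqI`. [folklore] -/
theorem checkIneqIB_eq (c : CapCert) (D : ℚ) (pts : List ℚ) (B : List (List ℚ))
    (hB : ∀ k, k < c.L.length → B.getD k [] = blockDiagN c k c.R) :
    checkIneqIB c D pts B = checkIneqI c D pts := by
  unfold checkIneqIB checkIneqI diagPoly
  rw [diagOfBlocksN_eq c B _ hB]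

/-- **Soundness of the hinted (I)-check**: correct hints and a `true` run give `c.IneqI D`.
[cite: BachocVallentin2009, Theorem 4.4 (d)] -/
theorem ineqI_of_checkB (c : CapCert) (D : ℚ) (pts : List ℚ) (B : List (List ℚ))
    (hB : ∀ k, k < c.L.length → B.getD k [] = blockDiagN c k c.R)
    (h : checkIneqIB c D pts B = true) : c.IneqI D :=
  ineqI_of_check c D pts (by rwa [checkIneqIB_eq c D pts B hB] at h)

end Summit.Ventures.Crystal3D.CapCut
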